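import Literature.AnabelianGeometry.SemiGraphs.TemperedCompactInVerticialFinite
import Literature.AnabelianGeometry.SemiGraphs.TemperedEdgeLikeIncomparableAt
import Literature.AnabelianGeometry.SemiGraphs.TemperedEdgeLikeCommensurator
import Mathlib.Data.ZMod.QuotientGroup
import HarnessLib

/-!
# [SemiAnbd] Thm 3.7 (iii)/(iv) and the edge-like residuals at a FINITE `𝔾`: consumer-facing closers

Mochizuki, *Semi-graphs of anabelioids*, Publ. RIMS **42** (2006) 221–322, §3, Theorem 3.7 (iii), (iv),
manuscript pp. 40–41 [cite: MochizukiSemiAnbd2006, Thm 3.7(iii)(iv) pp.40-41]: "(iii) Every compact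
subgroup of `π₁^temp(𝒢)` is contained in at least one verticial subgroup. If a nontrivial compact subgroup of
`π₁^temp(𝒢)` is contained in more than one verticial subgroup, then it is contained in precisely two verticial
subgroups … this compact subgroup is contained in the image of some `π̂₁(𝒢_e)`, for some edge `e` of `𝔾`.
(iv) The maximal compact subgroups of `π₁^temp(𝒢)` are precisely the verticial subgroups. The nontrivial
intersections of two distinct maximal compact subgroups of `π₁^temp(𝒢)` are precisely the edge-like
subgroups"; print's proof of (iii) runs over FINITE `𝔾` (p. 41 "Since the semi-graphs `𝔾_j` are all
finite").

PROOF-ONLY file (abc-iut cell, seat abc-iut-L3-t2 gen 3 — owner lineage of the §3 statement files —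
L3-lead ruling α20-9 row (c) «Thm 3.7 (iv) FINITE-GRAPH CLOSERS of the §3 At-chain»; no definition, no new
named fact).  INPUT BY NAME: Thm 3.7 (iii) at every finite `𝔾`,
`compactInVerticialAt_of_finiteGraph [Finite 𝒢.graph.Vertex] [Finite 𝒢.graph.Edge] : CompactInVerticialAt 𝒢`
(`TemperedCompactInVerticialFinite.lean`, seat abc-iut-L3-t8's assembly of the cell's (β)/φ-chain over seats
abc-iut-L3-t6/t9/t10/t11 and abc-iut-w4-d064), and Thm 3.7 (i), (ii) `verticialInjective_holds` /
`verticialDistinct_holds` (seats abc-iut-L3-t8, discharged in the tree).  OUTPUT: the per-graph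
(`…At 𝒢`) theorems of the lineage's maximal-compact / edge-like files (`TemperedMaximalCompactAt`,
`TemperedMaximalCompactProofsAt`, `TemperedEdgeLikeDistinctProofsAt`, `TemperedEdgeLikeIncomparableAt`, seat
abc-iut-w4-d075's φ2 twins of this lineage's `TemperedMaximalCompact*` / `TemperedEdgeLike*`, and seat
abc-iut-w4-d059's `TemperedEdgeLikeCommensurator`) with the binders `(hCV : CompactInVerticialAt 𝒢)`,
`(hVD : VerticialDistinct)`, `(hVI : VerticialInjective)` DISCHARGED, in UNBUNDLED form (one statement per
printed clause), so that a consumer at a finite `𝔾` — the dual semi-graph of a pointed stable curve is finite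
— cites Thm 3.7 (iii)/(iv) with exactly these remaining hypotheses: `[Finite 𝒢.graph.Vertex]`,
`[Finite 𝒢.graph.Edge]`, `𝒢.Thm37Hypotheses` (the printed hypotheses of Thm 3.7), and, for the
commensurator statements only, `𝒢.graph.IsGraph` (as in their per-graph originals).  NO residual named fact
remains in any statement of this file.  Nothing here asserts Thm 3.7 (iii) for an infinite `𝔾` (the
∀-countable frozen facts `CompactInVerticial` F-1732 / `MaximalCompactIffVerticial` F-1750 stay
open-as-typed for infinite `𝔾`); nothing here bears on [IUTchIII] Cor. 3.12.
-/

namespace Literature.AnabelianGeometry.SemiGraphs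

namespace ProfiniteSemiGraph

open Topology
open scoped Pointwise

universe u w

variable {𝒢 : ProfiniteSemiGraph.{u}} [Finite 𝒢.graph.Vertex] [Finite 𝒢.graph.Edge]

/-! ### Thm 3.7 (iii) at a finite `𝔾`, clause by clause -/

/-- **[SemiAnbd] Thm 3.7 (iii), first sentence, at a finite `𝔾`**: "Every compact subgroup of `π₁^temp(𝒢)`
is contained in at least one verticial subgroup." [cite: MochizukiSemiAnbd2006, Thm 3.7(iii) p.40] -/
theorem exists_mem_verticialSubgroups_ge_of_isCompact_of_finiteGraph (h𝒢 : 𝒢.Thm37Hypotheses)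
    (c : TemperedPiChart 𝒢) {C : Subgroup c.G} (hC : IsCompact (C : Set c.G)) :
    ∃ (v : 𝒢.graph.Vertex) (H : Subgroup c.G), H ∈ verticialSubgroups c v ∧ C ≤ H :=
  (compactInVerticialAt_of_finiteGraph h𝒢 c C hC).1

/-- **[SemiAnbd] Thm 3.7 (iii), second sentence, at a finite `𝔾`**: a nontrivial compact subgroup
contained in two distinct verticial subgroups `H₁`, `H₂` "is contained in precisely two verticial
subgroups" — any verticial subgroup containing it is `H₁` or `H₂`. [cite: MochizukiSemiAnbd2006, Thm 3.7(iii) pp.40-41] -/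
theorem verticial_eq_or_eq_of_ge_compact_of_finiteGraph (h𝒢 : 𝒢.Thm37Hypotheses)
    (c : TemperedPiChart 𝒢) {C : Subgroup c.G} (hC : IsCompact (C : Set c.G)) (hCne : C ≠ ⊥)
    {v₁ v₂ : 𝒢.graph.Vertex} {H₁ H₂ : Subgroup c.G} (hH₁ : H₁ ∈ verticialSubgroups c v₁)
    (hH₂ : H₂ ∈ verticialSubgroups c v₂) (hne : H₁ ≠ H₂) (hC₁ : C ≤ H₁) (hC₂ : C ≤ H₂)
    {v₃ : 𝒢.graph.Vertex} {H₃ : Subgroup c.G} (hH₃ : H₃ ∈ verticialSubgroups c v₃) (hC₃ : C ≤ H₃) :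
    H₃ = H₁ ∨ H₃ = H₂ :=
  ((compactInVerticialAt_of_finiteGraph h𝒢 c C hC).2 hCne v₁ v₂ H₁ H₂ hH₁ hH₂ hne hC₁ hC₂).1 v₃ H₃ hH₃ hC₃

/-- **[SemiAnbd] Thm 3.7 (iii), second sentence, at a finite `𝔾` (triviality form)**: a compact subgroup
contained in three pairwise distinct verticial subgroups is trivial. [cite: MochizukiSemiAnbd2006, Thm 3.7(iii) pp.40-41] -/
theorem eq_bot_of_le_three_verticial_of_finiteGraph (h𝒢 : 𝒢.Thm37Hypotheses) (c : TemperedPiChart 𝒢)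
    {C : Subgroup c.G} (hC : IsCompact (C : Set c.G)) {v₁ v₂ v₃ : 𝒢.graph.Vertex}
    {H₁ H₂ H₃ : Subgroup c.G} (hH₁ : H₁ ∈ verticialSubgroups c v₁) (hH₂ : H₂ ∈ verticialSubgroups c v₂)
    (hH₃ : H₃ ∈ verticialSubgroups c v₃) (h₁₂ : H₁ ≠ H₂) (h₁₃ : H₁ ≠ H₃) (h₂₃ : H₂ ≠ H₃)
    (hC₁ : C ≤ H₁) (hC₂ : C ≤ H₂) (hC₃ : C ≤ H₃) : C = ⊥ := by
  by_contra hCne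
  rcases verticial_eq_or_eq_of_ge_compact_of_finiteGraph h𝒢 c hC hCne hH₁ hH₂ h₁₂ hC₁ hC₂ hH₃ hC₃ with
    h | h
  · exact h₁₃ h.symm
  · exact h₂₃ h.symm

/-- **[SemiAnbd] Thm 3.7 (iii), last sentence, at a finite `𝔾`**: a nontrivial compact subgroup contained
in two distinct verticial subgroups "is contained in the image of some `π̂₁(𝒢_e)`" — in an edge-like
subgroup of a CLOSED edge `e`. [cite: MochizukiSemiAnbd2006, Thm 3.7(iii) p.41] -/
theorem exists_isClosedEdge_edgeLike_ge_of_finiteGraph (h𝒢 : 𝒢.Thm37Hypotheses)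
    (c : TemperedPiChart 𝒢) {C : Subgroup c.G} (hC : IsCompact (C : Set c.G)) (hCne : C ≠ ⊥)
    {v₁ v₂ : 𝒢.graph.Vertex} {H₁ H₂ : Subgroup c.G} (hH₁ : H₁ ∈ verticialSubgroups c v₁)
    (hH₂ : H₂ ∈ verticialSubgroups c v₂) (hne : H₁ ≠ H₂) (hC₁ : C ≤ H₁) (hC₂ : C ≤ H₂) :
    ∃ (e : 𝒢.graph.Edge) (L : Subgroup c.G), 𝒢.graph.IsClosedEdge e ∧ L ∈ edgeLikeSubgroups c e ∧ C ≤ L :=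
  ((compactInVerticialAt_of_finiteGraph h𝒢 c C hC).2 hCne v₁ v₂ H₁ H₂ hH₁ hH₂ hne hC₁ hC₂).2

/-- **Finite subgroups lie in verticial subgroups** (Thm 3.7 (iii), first sentence, at a finite `𝔾`, for a
finite — hence compact — subgroup). [cite: MochizukiSemiAnbd2006, Thm 3.7(iii) p.40] -/
theorem exists_mem_verticialSubgroups_ge_of_finite_of_finiteGraph (h𝒢 : 𝒢.Thm37Hypotheses)
    (c : TemperedPiChart 𝒢) (C : Subgroup c.G) [Finite C] :
    ∃ (v : 𝒢.graph.Vertex) (H : Subgroup c.G), H ∈ verticialSubgroups c v ∧ C ≤ H :=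
  exists_mem_verticialSubgroups_ge_of_isCompact_of_finiteGraph h𝒢 c
    (Set.Finite.isCompact (Set.toFinite (C : Set c.G)))

/-- **Torsion elements of `π₁^temp(𝒢)` lie in verticial subgroups** (Thm 3.7 (iii), first sentence, at a
finite `𝔾`, applied to the finite cyclic subgroup generated by an element of finite order).
[cite: MochizukiSemiAnbd2006, Thm 3.7(iii) p.40] -/
theorem exists_mem_verticialSubgroups_of_isOfFinOrder_of_finiteGraph (h𝒢 : 𝒢.Thm37Hypotheses)
    (c : TemperedPiChart 𝒢) {g : c.G} (hg : IsOfFinOrder g) :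
    ∃ (v : 𝒢.graph.Vertex) (H : Subgroup c.G), H ∈ verticialSubgroups c v ∧ g ∈ H := by
  obtain ⟨v, H, hH, hle⟩ := exists_mem_verticialSubgroups_ge_of_isCompact_of_finiteGraph h𝒢 c
    (C := Subgroup.zpowers g) hg.finite_zpowers.isCompact
  exact ⟨v, H, hH, hle (Subgroup.mem_zpowers g)⟩

/-- **Compact = closed and inside a vertex group** (finite `𝔾`): a closed subgroup of `π₁^temp(𝒢)` is compact
iff it is contained in some verticial subgroup (Thm 3.7 (iii), first sentence; verticial subgroups are
compact). [cite: MochizukiSemiAnbd2006, Thm 3.7(iii) p.40] -/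
theorem isCompact_iff_exists_verticial_ge_of_isClosed_of_finiteGraph (h𝒢 : 𝒢.Thm37Hypotheses)
    (c : TemperedPiChart 𝒢) {C : Subgroup c.G} (hC : IsClosed (C : Set c.G)) :
    IsCompact (C : Set c.G) ↔ ∃ (v : 𝒢.graph.Vertex) (H : Subgroup c.G), H ∈ verticialSubgroups c v ∧ C ≤ H :=
  ⟨exists_mem_verticialSubgroups_ge_of_isCompact_of_finiteGraph h𝒢 c, fun ⟨_, _, hH, hle⟩ =>
    (isCompact_of_mem_verticialSubgroups c hH).of_isClosed_subset hC (fun _ hx => hle hx)⟩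

/-! ### Thm 3.7 (iv) at a finite `𝔾`, clause by clause -/

/-- **[SemiAnbd] Thm 3.7 (iv), first sentence, at a finite `𝔾`**: "The maximal compact subgroups of
`π₁^temp(𝒢)` are precisely the verticial subgroups." [cite: MochizukiSemiAnbd2006, Thm 3.7(iv) p.41] -/
theorem isMaximalCompactSubgroup_iff_mem_verticialSubgroups_of_finiteGraph (h𝒢 : 𝒢.Thm37Hypotheses)
    (c : TemperedPiChart 𝒢) (K : Subgroup c.G) :
    IsMaximalCompactSubgroup K ↔ ∃ v, K ∈ verticialSubgroups c v :=
  isMaximalCompactSubgroup_iff_mem_verticialSubgroups_at compactInVerticialAt_of_finiteGraph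
    verticialDistinct_holds h𝒢 c K

/-- Thm 3.7 (iv), first sentence, at a finite `𝔾` — verticial subgroups are maximal compact subgroups.
[cite: MochizukiSemiAnbd2006, Thm 3.7(iv) p.41] -/
theorem isMaximalCompactSubgroup_of_mem_verticialSubgroups_of_finiteGraph (h𝒢 : 𝒢.Thm37Hypotheses)
    (c : TemperedPiChart 𝒢) {v : 𝒢.graph.Vertex} {H : Subgroup c.G} (hH : H ∈ verticialSubgroups c v) :
    IsMaximalCompactSubgroup H :=
  (isMaximalCompactSubgroup_iff_mem_verticialSubgroups_of_finiteGraph h𝒢 c H).2 ⟨v, hH⟩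

/-- Thm 3.7 (iv), first sentence, at a finite `𝔾` — a maximal compact subgroup is verticial at some vertex.
[cite: MochizukiSemiAnbd2006, Thm 3.7(iv) p.41] -/
theorem exists_mem_verticialSubgroups_of_isMaximalCompactSubgroup_of_finiteGraph
    (h𝒢 : 𝒢.Thm37Hypotheses) (c : TemperedPiChart 𝒢) {K : Subgroup c.G}
    (hK : IsMaximalCompactSubgroup K) : ∃ v, K ∈ verticialSubgroups c v :=
  (isMaximalCompactSubgroup_iff_mem_verticialSubgroups_of_finiteGraph h𝒢 c K).1 hK

/-- **Every compact subgroup of `π₁^temp(𝒢)` lies in a maximal compact subgroup** (finite `𝔾`; Thm 3.7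
(iii) first sentence with (iv) first sentence). [cite: MochizukiSemiAnbd2006, Thm 3.7(iv) p.41] -/
theorem exists_isMaximalCompactSubgroup_ge_of_isCompact_of_finiteGraph (h𝒢 : 𝒢.Thm37Hypotheses)
    (c : TemperedPiChart 𝒢) {C : Subgroup c.G} (hC : IsCompact (C : Set c.G)) :
    ∃ K : Subgroup c.G, IsMaximalCompactSubgroup K ∧ C ≤ K := by
  obtain ⟨v, H, hH, hCH⟩ := exists_mem_verticialSubgroups_ge_of_isCompact_of_finiteGraph h𝒢 c hC
  exact ⟨H, isMaximalCompactSubgroup_of_mem_verticialSubgroups_of_finiteGraph h𝒢 c hH, hCH⟩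

/-- **Maximal compact subgroups exist** (finite `𝔾`): `π₁^temp(𝒢)` has a vertex (hypotheses of Thm 3.7) and
its verticial subgroups are maximal compact (Thm 3.7 (iv)). [cite: MochizukiSemiAnbd2006, Thm 3.7(iv) p.41] -/
theorem exists_isMaximalCompactSubgroup_of_finiteGraph (h𝒢 : 𝒢.Thm37Hypotheses) (c : TemperedPiChart 𝒢) :
    ∃ K : Subgroup c.G, IsMaximalCompactSubgroup K := by
  obtain ⟨v⟩ := h𝒢.hasVertex
  obtain ⟨H, hH⟩ := (verticialInjective_holds 𝒢 h𝒢 c v).1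
  exact ⟨H, isMaximalCompactSubgroup_of_mem_verticialSubgroups_of_finiteGraph h𝒢 c hH⟩

/-- **Distinct maximal compact subgroups have infinite mutual index** (finite `𝔾`; Thm 3.7 (iv) with (ii):
distinct verticial subgroups arise from distinct parametrization data `(v, g·π̂₁(𝒢_v))`).
[cite: MochizukiSemiAnbd2006, Thm 3.7(ii)(iv) pp.40-41] -/
theorem relIndex_eq_zero_of_ne_of_isMaximalCompactSubgroup_of_finiteGraph (h𝒢 : 𝒢.Thm37Hypotheses)
    (c : TemperedPiChart 𝒢) {K₁ K₂ : Subgroup c.G} (hK₁ : IsMaximalCompactSubgroup K₁)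
    (hK₂ : IsMaximalCompactSubgroup K₂) (hne : K₁ ≠ K₂) : K₂.relIndex K₁ = 0 := by
  obtain ⟨v₁, hH₁⟩ := exists_mem_verticialSubgroups_of_isMaximalCompactSubgroup_of_finiteGraph h𝒢 c hK₁
  obtain ⟨v₂, hH₂⟩ := exists_mem_verticialSubgroups_of_isMaximalCompactSubgroup_of_finiteGraph h𝒢 c hK₂
  by_cases hv : v₁ = v₂
  · subst hv
    obtain ⟨g, rfl⟩ := exists_conj_of_mem_verticialSubgroups c hH₁ hH₂
    have hg : (1 : c.G)⁻¹ * g ∉ K₁ := by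
      intro hg1
      apply hne
      rw [inv_one, one_mul] at hg1
      ext x
      constructor
      · intro hx
        exact ⟨g⁻¹ * x * g⁻¹⁻¹, by
          simpa [mul_assoc] using K₁.mul_mem (K₁.mul_mem (K₁.inv_mem hg1) hx) hg1, by simp [mul_assoc]⟩
      · rintro ⟨y, hy, rfl⟩
        simpa using K₁.mul_mem (K₁.mul_mem hg1 hy) (K₁.inv_mem hg1)
    have h2 := (verticialDistinct_holds 𝒢 h𝒢 c).2 v₁ K₁ hH₁ 1 g hg
    have h1 : K₁.map (MulAut.conj (1 : c.G)).toMonoidHom = K₁ := by ext x; simp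
    rw [h1] at h2
    exact h2
  · exact (verticialDistinct_holds 𝒢 h𝒢 c).1 v₁ v₂ K₁ K₂ hH₁ hH₂ hv

/-- **[SemiAnbd] Thm 3.7 (iv), second sentence, at a finite `𝔾`**: "The nontrivial intersections of two
distinct maximal compact subgroups of `π₁^temp(𝒢)` are precisely the edge-like subgroups" (of closed edges).
[cite: MochizukiSemiAnbd2006, Thm 3.7(iv) p.41] -/
theorem exists_maximalCompact_pair_iff_edgeLike_of_finiteGraph (h𝒢 : 𝒢.Thm37Hypotheses)
    (c : TemperedPiChart 𝒢) {L : Subgroup c.G} (hL : L ≠ ⊥) :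
    (∃ K₁ K₂ : Subgroup c.G, IsMaximalCompactSubgroup K₁ ∧ IsMaximalCompactSubgroup K₂ ∧
        K₁ ≠ K₂ ∧ L = K₁ ⊓ K₂) ↔ ∃ e, 𝒢.graph.IsClosedEdge e ∧ L ∈ edgeLikeSubgroups c e :=
  ((maximalCompactIffVerticialAt_of_compactInVerticialAt compactInVerticialAt_of_finiteGraph) h𝒢 c).2 L hL

/-- Thm 3.7 (iv), second sentence, at a finite `𝔾` — a nontrivial edge-like subgroup of a closed edge is the
intersection of two distinct VERTICIAL subgroups (the rung-4 residual `EdgeLikeIsInfVerticialAt`, unbundled).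
[cite: MochizukiSemiAnbd2006, Thm 3.7(iv) p.41] -/
theorem exists_verticial_pair_eq_inf_of_mem_edgeLikeSubgroups_of_finiteGraph (h𝒢 : 𝒢.Thm37Hypotheses)
    (c : TemperedPiChart 𝒢) {e : 𝒢.graph.Edge} (he : 𝒢.graph.IsClosedEdge e) {L : Subgroup c.G}
    (hL : L ∈ edgeLikeSubgroups c e) (hLne : L ≠ ⊥) :
    ∃ (v₁ v₂ : 𝒢.graph.Vertex) (H₁ H₂ : Subgroup c.G), H₁ ∈ verticialSubgroups c v₁ ∧
      H₂ ∈ verticialSubgroups c v₂ ∧ H₁ ≠ H₂ ∧ L = H₁ ⊓ H₂ :=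
  edgeLikeIsInfVerticialAt_of_compactInVerticialAt compactInVerticialAt_of_finiteGraph h𝒢 c e he L hL hLne

/-- Thm 3.7 (iv), second sentence, at a finite `𝔾` — a nontrivial edge-like subgroup of a closed edge is the
intersection of two distinct MAXIMAL COMPACT subgroups. [cite: MochizukiSemiAnbd2006, Thm 3.7(iv) p.41] -/
theorem exists_maximalCompact_pair_eq_inf_of_mem_edgeLikeSubgroups_of_finiteGraph
    (h𝒢 : 𝒢.Thm37Hypotheses) (c : TemperedPiChart 𝒢) {e : 𝒢.graph.Edge} (he : 𝒢.graph.IsClosedEdge e)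
    {L : Subgroup c.G} (hL : L ∈ edgeLikeSubgroups c e) (hLne : L ≠ ⊥) :
    ∃ K₁ K₂ : Subgroup c.G, IsMaximalCompactSubgroup K₁ ∧ IsMaximalCompactSubgroup K₂ ∧
      K₁ ≠ K₂ ∧ L = K₁ ⊓ K₂ :=
  (exists_maximalCompact_pair_iff_edgeLike_of_finiteGraph h𝒢 c hLne).2 ⟨e, he, hL⟩

/-- Thm 3.7 (iv), second sentence, at a finite `𝔾` — a nontrivial intersection of two distinct maximal compact
subgroups is an edge-like subgroup of some closed edge. [cite: MochizukiSemiAnbd2006, Thm 3.7(iv) p.41] -/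
theorem exists_isClosedEdge_of_inf_maximalCompact_ne_bot_of_finiteGraph (h𝒢 : 𝒢.Thm37Hypotheses)
    (c : TemperedPiChart 𝒢) {K₁ K₂ : Subgroup c.G} (hK₁ : IsMaximalCompactSubgroup K₁)
    (hK₂ : IsMaximalCompactSubgroup K₂) (hne : K₁ ≠ K₂) (hbot : K₁ ⊓ K₂ ≠ ⊥) :
    ∃ e, 𝒢.graph.IsClosedEdge e ∧ K₁ ⊓ K₂ ∈ edgeLikeSubgroups c e :=
  (exists_maximalCompact_pair_iff_edgeLike_of_finiteGraph h𝒢 c hbot).1 ⟨K₁, K₂, hK₁, hK₂, hne, rfl⟩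

/-! ### Edge-like subgroups at a finite `𝔾`: distinct edges, incomparability, commensurable termination -/

/-- **Edge-like subgroups of distinct edges meet trivially** (Thm 3.7 (ii) for edges, at a finite `𝔾`).
[cite: MochizukiSemiAnbd2006, Thm 3.7(ii)(iv) pp.40-41] -/
theorem edgeLike_inf_edgeLike_eq_bot_of_finiteGraph (h𝒢 : 𝒢.Thm37Hypotheses) (c : TemperedPiChart 𝒢)
    {e₁ e₂ : 𝒢.graph.Edge} (hne : e₁ ≠ e₂) {L₁ L₂ : Subgroup c.G} (hL₁ : L₁ ∈ edgeLikeSubgroups c e₁)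
    (hL₂ : L₂ ∈ edgeLikeSubgroups c e₂) : L₁ ⊓ L₂ = ⊥ :=
  edgeLike_inf_edgeLike_eq_bot_at compactInVerticialAt_of_finiteGraph verticialDistinct_holds
    verticialInjective_holds h𝒢 c hne hL₁ hL₂

/-- **`EdgeLikeDistinct`, unfolded, at a finite `𝔾`**: edge-like subgroups of distinct edges have infinite
mutual index, `L₂.relIndex L₁ = 0`. [cite: MochizukiSemiAnbd2006, Thm 3.7(ii)(iv) pp.40-41] -/
theorem relIndex_edgeLike_eq_zero_of_finiteGraph (h𝒢 : 𝒢.Thm37Hypotheses) (c : TemperedPiChart 𝒢)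
    {e₁ e₂ : 𝒢.graph.Edge} (hne : e₁ ≠ e₂) {L₁ L₂ : Subgroup c.G} (hL₁ : L₁ ∈ edgeLikeSubgroups c e₁)
    (hL₂ : L₂ ∈ edgeLikeSubgroups c e₂) : L₂.relIndex L₁ = 0 :=
  relIndex_edgeLike_eq_zero_at compactInVerticialAt_of_finiteGraph verticialDistinct_holds
    verticialInjective_holds h𝒢 c hne hL₁ hL₂

/-- **Nested edge-like subgroups are equal** (at a finite `𝔾`; edge-like subgroups are pairwise
incomparable). [cite: MochizukiSemiAnbd2006, Thm 3.7(iii)(iv) p.41] -/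
theorem eq_of_le_of_mem_edgeLikeSubgroups_of_finiteGraph (h𝒢 : 𝒢.Thm37Hypotheses)
    (c : TemperedPiChart 𝒢) {e e' : 𝒢.graph.Edge} {L L' : Subgroup c.G} (hL : L ∈ edgeLikeSubgroups c e)
    (hL' : L' ∈ edgeLikeSubgroups c e') (hle : L ≤ L') : L = L' :=
  eq_of_le_of_mem_edgeLikeSubgroups_at compactInVerticialAt_of_finiteGraph verticialDistinct_holds
    verticialInjective_holds h𝒢 c hL hL' hle

/-- Nested edge-like subgroups belong to the same edge (at a finite `𝔾`).
[cite: MochizukiSemiAnbd2006, Thm 3.7(iii)(iv) p.41] -/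
theorem edge_eq_of_le_of_mem_edgeLikeSubgroups_of_finiteGraph (h𝒢 : 𝒢.Thm37Hypotheses)
    (c : TemperedPiChart 𝒢) {e e' : 𝒢.graph.Edge} {L L' : Subgroup c.G} (hL : L ∈ edgeLikeSubgroups c e)
    (hL' : L' ∈ edgeLikeSubgroups c e') (hle : L ≤ L') : e = e' := by
  by_contra hne
  have hbot := edgeLike_inf_edgeLike_eq_bot_of_finiteGraph h𝒢 c hne hL hL'
  rw [inf_eq_left.mpr hle] at hbot
  exact ne_bot_of_mem_edgeLikeSubgroups verticialInjective_holds h𝒢 c hL hbot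

/-- **Nested images of edge-like subgroups under an injective homomorphism are equal** (at a finite `𝔾`; the
transported form consumed at an ambient group `Π ⊇ π₁^temp(𝒢)`). [cite: MochizukiSemiAnbd2006, Thm 3.7(iv) p.41] -/
theorem map_edgeLike_eq_of_le_of_finiteGraph {Gtp : Type w} [Group Gtp] (h𝒢 : 𝒢.Thm37Hypotheses)
    (c : TemperedPiChart 𝒢) (ι : c.G →* Gtp) (hι : Function.Injective ι) {L L' : Subgroup Gtp}
    (hL : ∃ e : 𝒢.graph.Edge, ∃ K ∈ edgeLikeSubgroups c e, L = K.map ι)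
    (hL' : ∃ e : 𝒢.graph.Edge, ∃ K ∈ edgeLikeSubgroups c e, L' = K.map ι) (hle : L ≤ L') : L = L' :=
  map_edgeLike_eq_of_le_at c ι compactInVerticialAt_of_finiteGraph verticialDistinct_holds
    verticialInjective_holds h𝒢 hι hL hL' hle

/-- **Commensurable edge-like subgroups are equal** (at a finite graph `𝔾`).
[cite: MochizukiSemiAnbd2006, Thm 3.7(iii)(iv) pp.40-41] -/
theorem eq_of_commensurable_of_mem_edgeLikeSubgroups_of_finiteGraph (h𝒢 : 𝒢.Thm37Hypotheses)
    (hG : 𝒢.graph.IsGraph) (c : TemperedPiChart 𝒢) {e e' : 𝒢.graph.Edge} {L L' : Subgroup c.G}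
    (hL : L ∈ edgeLikeSubgroups c e) (hL' : L' ∈ edgeLikeSubgroups c e')
    (hc : Subgroup.Commensurable L L') : L = L' :=
  eq_of_commensurable_of_mem_edgeLikeSubgroupsAt compactInVerticialAt_of_finiteGraph h𝒢 hG c hL hL' hc

/-- **Edge-like subgroups are commensurably terminal, `C(L) = L`** (at a finite graph `𝔾`; [SemiAnbd] §5
p. 65: the branch decomposition groups "may be thought of as the commensurator").
[cite: MochizukiSemiAnbd2006, Thm 3.7(iii)(iv) pp.40-41] -/
theorem commensurator_eq_of_mem_edgeLikeSubgroups_of_finiteGraph (h𝒢 : 𝒢.Thm37Hypotheses)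
    (hG : 𝒢.graph.IsGraph) (c : TemperedPiChart 𝒢) {e : 𝒢.graph.Edge} {L : Subgroup c.G}
    (hL : L ∈ edgeLikeSubgroups c e) : Subgroup.Commensurable.commensurator L = L :=
  commensurator_eq_of_mem_edgeLikeSubgroupsAt compactInVerticialAt_of_finiteGraph h𝒢 hG c hL

/-- **Edge-like subgroups are normally terminal, `N(L) = L`** (at a finite graph `𝔾`).
[cite: MochizukiSemiAnbd2006, Thm 3.7(iii)(iv) pp.40-41] -/
theorem normalizer_eq_of_mem_edgeLikeSubgroups_of_finiteGraph (h𝒢 : 𝒢.Thm37Hypotheses)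
    (hG : 𝒢.graph.IsGraph) (c : TemperedPiChart 𝒢) {e : 𝒢.graph.Edge} {L : Subgroup c.G}
    (hL : L ∈ edgeLikeSubgroups c e) : Subgroup.normalizer (L : Set c.G) = L :=
  normalizer_eq_of_mem_edgeLikeSubgroupsAt compactInVerticialAt_of_finiteGraph h𝒢 hG c hL

/-- An element normalising an edge-like subgroup lies in it (membership form, at a finite graph `𝔾`).
[cite: MochizukiSemiAnbd2006, Thm 3.7(iii)(iv) pp.40-41] -/
theorem mem_of_smul_eq_of_mem_edgeLikeSubgroups_of_finiteGraph (h𝒢 : 𝒢.Thm37Hypotheses)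
    (hG : 𝒢.graph.IsGraph) (c : TemperedPiChart 𝒢) {e : 𝒢.graph.Edge} {L : Subgroup c.G}
    (hL : L ∈ edgeLikeSubgroups c e) {g : c.G} (hg : ConjAct.toConjAct g • L = L) : g ∈ L :=
  mem_of_smul_eq_of_mem_edgeLikeSubgroupsAt compactInVerticialAt_of_finiteGraph h𝒢 hG c hL hg

end ProfiniteSemiGraph

end Literature.AnabelianGeometry.SemiGraphs
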